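import Literature.AlgebraicGeometry.Milne1999.SpecialLefschetzGroupInvariantsSpBlocksMultiplicity
import Literature.AlgebraicGeometry.Motives.HodgeStructureExteriorPowerPrimitiveIrreducible
import Literature.RepresentationTheory.ClassicalInvariants.InvolutiveModuleFormBlocks
import HarnessLib

/-!
# Milne 1999, Thm. 3.2 / Prop. 3.4 with Prop. 3.6 and §2, ABSTRACT FORM ON THE EXTERIOR ALGEBRA: for a non-degenerate
# alternating form `B` on `W` and a semisimple `†`-stable algebra of operators `E ⊆ End_K W` (`K` algebraically closed of
# characteristic `0`), the invariants of `S(E, B) = {u ∈ GL(W) | uX = Xu (X ∈ E), B(u·, u·) = B}` in `⋀• W` are generated,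
# as a `K`-algebra, by the invariants of degree `2`: `(⋀^m W)^{S(E,B)} ⊆ K[(⋀² W)^{S(E,B)}]`

[topic AlgebraicGeometry/Milne1999]

Family `hodge`, layer `Literature/AlgebraicGeometry/Milne1999`, namespace `Literature.AlgebraicGeometry.Milne1999`; lane
`lit-hodgefound` (Track 2 foundations library; seat `lit-hodgefound-p34`, generation 25, self-proposed row g25-#1).
THEOREMS ONLY: no definition, no named fact, no `sorry` (D-0026, net debt `0`).

## Source, verbatim

J. S. Milne, *Lefschetz classes on abelian varieties*, Duke Math. J. **96** (1999) 639–675 [`Milne1999LefschetzClasses`,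
held `paper:doi-10-1215-s0012-7094-99-09620-5`; PDF page = printed page − 638]:

* p. 653 (p0015 L24–L36): "we obtain an action of `S(A)` on `H^*(A^r)` for all `r`. […] **Theorem 3.2.** For any abelian
  variety `A` over `Ω` and integer `r ≥ 0`, the `k`-algebra `H^*(A^r)^{S(A)}` is generated by divisor classes. This will be a
  consequence of the following two propositions. **Proposition 3.3.** […] the `k`-vector space `H²(A^r)^{S(A)}` is generated
  by divisor classes. For a `k`-algebra `R` and a subset `W` of `R`, we let `k[W]` denote the smallest `k`-subalgebra of `R`
  containing `W`. **Proposition 3.4.** For any abelian variety `A` over `Ω` and any integer `r`,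
  `H^*(A^r)^{S(A)} = k[H²(A^r)^{S(A)}]`."
* p. 644 (§1): "`S(A)(R) = {γ ∈ C(A) ⊗_k R | γ†γ = 1}`", `C(A)` the centralizer of `End⁰(A)` in `End_k(V(A))`, `†` the
  adjoint for `e_D`; §2 pp. 645–651: `(E ⊗ k, †)` semisimple with involution, decomposed into the types `Sp` / `O` / `GL`;
  p. 654–655 Prop. 3.6 (a) `Sp(φ)`, (b) `O(φ)`, (c) `GL(W)`, `V = W ⊕ W^∨`: "`(⋀^*(rH))^G = k[(⊗² rH)^G]`"; p. 656:
  "`H = ⊕_σ H_σ`, `S(A) = ∏_σ S_σ`, and so `(⋀^*(⊕ rH_σ))^{∏ S_σ} = ⊗_σ (⋀^* rH_σ)^{S_σ}` […] each of the `k`-algebras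
  `(⋀^* rH_σ)^{S_σ}` is generated by tensors of degree `2`, which completes the proof."

## What is proved (no abelian variety, no cohomology: a `K`-space `W`, a form `B`, an algebra `E`)

The statement `H^*(A)^{S(A)} = k[H²(A)^{S(A)}]` (Prop. 3.4, `r = 1`, `k` algebraically closed) only uses: `V(A) ⊗ k =: W`
finite-dimensional, `e_D =: B` non-degenerate alternating, `End⁰(A) ⊗ k =: E ⊆ End_K W` semisimple and `†`-stable, and
`S(A)(k) = S(E, B)`.  In that generality, with `S(E, B)` presented as ANY subgroup `G ≤ GL(W)` whose membership is
"commutes with `E` and preserves `B`" (hypothesis `hG`), and with Milne's `H^* = ⋀^*` realised as Mathlib's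
`ExteriorAlgebra K W ⊇ ⋀[K]^m W`, `u ∈ GL(W)` acting by `ExteriorAlgebra.map u` (`= exteriorPower.map m u` on `⋀^m`):

* §1 coefficients of `m`-vectors on the words in a basis (`wordEval (ExteriorAlgebra.ιMulti K m)` of the tree's
  `GeneralLinear/AlternatingWordCoefficients`): `⋀(u)` moves the letters (`exteriorAlgebra_map_wordEval`), every
  `x ∈ ⋀^m W` has an antisymmetric coefficient function (`exists_isAntisymm_wordEval_ιMulti_eq`), and `⋀(u) x = x` makes the slices
  of that function invariant under the Kronecker powers of the matrices of `u` (`wordRepAt_wordSlice_eq_of_map_wordEval_eq`) —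
  the exterior-algebra twins of the `H^{2p}(A(ℂ); ℂ)`-lemmas of `Milne1999/SpecialLefschetzGroupInvariantsSp2Multiplicity` /
  `…GLMultiplicity`;
* §2 the contracted pair words are PRODUCTS of `2`-vectors (`sum_smul_ιMulti_spPairWord_mem`: "each of which is visibly a
  product of `2`-forms", Prop. 3.6 / Remark 3.7), so they lie in any subalgebra containing the crossed `2`-vectors;
* §3 **the letter-coloured criterion on `⋀• W`** (`mem_adjoin_of_forall_map_eq_of_letterColouring`): the twin of
  `Milne1999/SpecialLefschetzGroupInvariantsLetterColouring.mem_divisorClassesSpan_of_forall_exteriorPullback_eq_of_letterColouring`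
  with `divisorClassesSpan` replaced by `K[S] = Algebra.adjoin K S` for any set `S` containing the kernel `2`-vectors
  (abstract one-colour first fundamental theorems `hone`, as supplied by `ClassicalInvariants/TensorFFTLetterColoured`);
* §4 the kernel `2`-vectors `κ_M = Σ M_{jj'} β_j ∧ β_{j'}` are `S(E, B)`-invariant: the contraction form of `κ_M` against
  `B(v, ·)` is `ψ ↦ ψ(X v)` for the operator `X ∈ E` of the adapted colouring (`contractionForm_kernelTwoVector`), so an
  isometry of `B` commuting with `X` fixes `κ_M` (`map_kernelTwoVector_eq`; a `2`-vector is its contraction form,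
  `ExteriorLefschetz.eq_of_contractionForm_eq` / `contractionForm_map` of the abstract exterior-power files) — the
  exterior-algebra form of the degree-`2` step "`(⊗²)^{S}` = divisor classes" used in the ℂ-Betti assembly;
* §5 **MAIN** `mem_adjoin_of_forall_map_eq` (`K` algebraically closed, characteristic `0`): every `x ∈ ⋀^m W` fixed by
  `S(E, B)` lies in `K[(⋀² W)^{S(E,B)}]`, the `K`-subalgebra of `⋀ W` generated by the `S(E, B)`-invariant `2`-vectors; the
  `⋀[K]^m W`-subtype form `coe_mem_adjoin_of_forall_exteriorPower_map_eq`; odd `m`: `x = 0` (`eq_zero_of_map_neg_eq_of_odd`,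
  `−1 ∈ S(E, B)`).  Proof = Milne's (§2 structure of `(E, †)` ↦ the tree's adapted letter colouring
  `ClassicalInvariants.exists_adaptedColouring_of_isAlgClosed`; Prop. 3.6 (a)/(b)/(c) ↦ the letter-coloured tensor FFTs
  `mem_span_pairContraction_of_formBlock_invariant` / `…_of_glBlock_invariant`; p. 656 ↦ §3), exactly as assembled on the
  ℂ-Betti carrier in `Milne1999/SpecialLefschetzGroupInvariantsHolds` — here the block-group elements lie in `G` by the
  membership test `hG` and the kernel classes are invariant by §4;
* §6 **the whole algebra** `mem_adjoin_of_forall_map_eq'` / `setOf_forall_map_eq_eq_adjoin`: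
  `(⋀ W)^{S(E,B)} = K[(⋀² W)^{S(E,B)}]` AS SETS, for arbitrary (non-homogeneous) elements — `⋀(u)` commutes with the
  projections onto the graded pieces (`coe_decompose_map`, Mathlib's `ExteriorAlgebra.gradedAlgebra`).

NOT here (sequel rows of this seat): the reading on `K`-points `S(H)(K)` of a polarized `ℚ`-Hodge structure
(`Motives/HodgeStructureLefschetzGroupPoints`), Prop. 3.3 in covariant form, `r ≥ 2`, descent to non-closed `K` (Lemma 3.1).

## References

* [Milne1999LefschetzClasses] J. S. Milne, Lefschetz classes on abelian varieties, Duke Math. J. 96 (1999) 639–675: §1 p. 644,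
  §2 pp. 645–651, §3 Thm. 3.2, Prop. 3.3, Prop. 3.4 (p. 653), Prop. 3.6 (pp. 654–655), Remark 3.7, p. 656.
* [GoodmanWallachGTM255] R. Goodman, N. R. Wallach, Symmetry, Representations, and Invariants, GTM 255 (2009), §4.1.1,
  Thm. 5.3.1, Thm. 5.3.3, Thm. 5.3.5.
* [Greub1978Multilinear] W. Greub, Multilinear Algebra, 2nd ed. (1978), §4.2, §5.7.
* [BourbakiAlgebre1a3] N. Bourbaki, Algèbre, Ch. III §7 (exterior algebra, `⋀(u)`), §11 no. 9 (interior products).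
-/

noncomputable section

open scoped BigOperators Matrix
open Literature.AlgebraicGeometry.HodgeTheory (posEquiv)
open Literature.AlgebraicGeometry.Motives.ExteriorLefschetz (contractionForm contractionForm_map contractionForm_sum
  contractionForm_smul contractionForm_ι_mul_ι eq_of_contractionForm_eq exists_eq_apply coe_exteriorPower_map)
open Literature.RepresentationTheory.GeneralLinear
open Literature.RepresentationTheory.ClassicalInvariants
open Literature.NumberTheory.DiophantineGeometry

namespace Literature.AlgebraicGeometry.Milne1999

/-! ### §1 Coefficients of `m`-vectors on the words in a basis, and their invariance -/

section Coefficients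

variable {K : Type*} [Field K] {W : Type*} [AddCommGroup W] [Module K W] {I : Type*} [Fintype I] {d : ℕ}

/-- **`⋀(u)` acts on an evaluation by moving the letters**:
`⋀(u) (∑_w a(w) · y_{w(0)} ∧ ⋯ ∧ y_{w(d-1)}) = ∑_w a(w) · (u y)_{w(0)} ∧ ⋯ ∧ (u y)_{w(d-1)}`.
[cite: BourbakiAlgebre1a3, Ch. III §7 no. 2] [cite: Greub1978Multilinear, §5.7 (5.12)] -/
theorem exteriorAlgebra_map_wordEval (u : W →ₗ[K] W) (y : I → W) (a : (Fin d → I) → K) :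
    ExteriorAlgebra.map u (wordEval (ExteriorAlgebra.ιMulti K d) y a) =
      wordEval (ExteriorAlgebra.ιMulti K d) (fun i => u (y i)) a := by
  rw [wordEval_apply, wordEval_apply, map_sum]
  refine Finset.sum_congr rfl fun w _ => ?_
  rw [map_smul, ExteriorAlgebra.map_apply_ιMulti]
  rfl

/-- The linear map `⋀^d W → ⋀ W` attached to the alternating map `ιMulti : W^d → ⋀ W` is the inclusion of the graded piece.
[cite: BourbakiAlgebre1a3, Ch. III §7 no. 1] -/
theorem alternatingMapLinearEquiv_ιMulti_eq_subtype :
    exteriorPower.alternatingMapLinearEquiv (ExteriorAlgebra.ιMulti K d (M := W)) = (⋀[K]^d W).subtype := by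
  have h : ExteriorAlgebra.ιMulti K d (M := W) =
      (⋀[K]^d W).subtype.compAlternatingMap (exteriorPower.ιMulti K d) := by
    ext v
    rfl
  rw [h, exteriorPower.alternatingMapLinearEquiv_comp, exteriorPower.alternatingMapLinearEquiv_ιMulti,
    LinearMap.comp_id]

/-- … in particular it is injective (the input `hF` of the uniqueness of antisymmetric coefficients,
`GeneralLinear.IsAntisymm.eq_of_wordEval_eq`). [cite: Greub1978Multilinear, §5.7 (5.12)–(5.13)] -/
theorem injective_alternatingMapLinearEquiv_ιMulti :
    Function.Injective (exteriorPower.alternatingMapLinearEquiv (ExteriorAlgebra.ιMulti K d (M := W))) := by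
  rw [alternatingMapLinearEquiv_ιMulti_eq_subtype]
  exact Subtype.val_injective

/-- Every pure wedge `v₀ ∧ ⋯ ∧ v_{d-1}` is an evaluation on the words in a basis (multilinear expansion).
[cite: Greub1978Multilinear, §5.7 (5.12)] -/
theorem ιMulti_mem_range_wordEval (b : Module.Basis I K W) (v : Fin d → W) :
    ExteriorAlgebra.ιMulti K d v ∈ LinearMap.range (wordEval (ExteriorAlgebra.ιMulti K d) (⇑b)) := by
  classical
  set F := ExteriorAlgebra.ιMulti K d (M := W) with hF
  have hv : v = fun i => ∑ j, b.repr (v i) j • b j := funext fun i => (b.sum_repr (v i)).symm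
  refine ⟨fun w => ∏ i, b.repr (v i) (w i), ?_⟩
  rw [wordEval_apply]
  conv_rhs => rw [hv]
  have h2 := F.toMultilinearMap.map_sum fun i j => b.repr (v i) j • b j
  simp only [AlternatingMap.coe_multilinearMap] at h2
  rw [h2]
  refine Finset.sum_congr rfl fun w _ => ?_
  have h3 := F.toMultilinearMap.map_smul_univ (fun i => b.repr (v i) (w i)) fun i => b (w i)
  simp only [AlternatingMap.coe_multilinearMap] at h3
  rw [h3]
  rfl

/-- **Every `x ∈ ⋀^d W` has an ANTISYMMETRIC coefficient function on the words in a basis** (the pure wedges span `⋀^d W`;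
antisymmetrise, Greub §4.2). [cite: Greub1978Multilinear, §4.2 (4.2) and §5.7 (5.12)] -/
theorem exists_isAntisymm_wordEval_ιMulti_eq [CharZero K] (b : Module.Basis I K W) {x : ExteriorAlgebra K W}
    (hx : x ∈ ⋀[K]^d W) :
    ∃ a : (Fin d → I) → K, IsAntisymm a ∧ wordEval (ExteriorAlgebra.ιMulti K d) b a = x := by
  have hxmem : x ∈ LinearMap.range (wordEval (ExteriorAlgebra.ιMulti K d) (⇑b)) := by
    rw [← ExteriorAlgebra.ιMulti_span_fixedDegree] at hx
    refine (Submodule.span_le.2 ?_) hx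
    rintro _ ⟨v, rfl⟩
    exact ιMulti_mem_range_wordEval b v
  obtain ⟨a₀, ha₀⟩ := hxmem
  exact ⟨antisymm a₀, isAntisymm_antisymm a₀, by rw [wordEval_antisymm, ha₀]⟩

variable {J : Type*} [Fintype J] [DecidableEq J] {n : ℕ}

/-- **Invariance of `x ∈ ⋀^d W` under `⋀(u)` ⟹ invariance of the slices of its antisymmetric coefficient function under
the Kronecker products of the matrices of `u`** (letters `J × Fin n`, `u(b(s,ℓ)) = ∑_{ℓ'} (G_s)_{ℓ' ℓ} b(s,ℓ')`): the twin on
`⋀ W` of `Milne1999/SpecialLefschetzGroupInvariantsGLMultiplicity.wordRepAt_wordSlice_eq_of_exteriorPullback_eq'`, same proof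
(`⋀(u) x` has the coefficient function `colourChangeAt G a`, antisymmetric with the same evaluation, hence equal to `a`).
[cite: Greub1978Multilinear, §5.7 (5.12)–(5.13)] [cite: FultonYoungTableaux1997, §8.1] -/
theorem wordRepAt_wordSlice_eq_of_map_wordEval_eq [CharZero K] (b : Module.Basis (J × Fin n) K W)
    {a : (Fin d → J × Fin n) → K} (ha : IsAntisymm a) (u : W →ₗ[K] W) (G : J → Matrix (Fin n) (Fin n) K)
    (hu : ∀ s ℓ, u (b (s, ℓ)) = ∑ ℓ', G s ℓ' ℓ • b (s, ℓ'))
    (hx : ExteriorAlgebra.map u (wordEval (ExteriorAlgebra.ιMulti K d) b a) =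
      wordEval (ExteriorAlgebra.ιMulti K d) b a)
    (t : Fin d → J) : wordRepAt K (fun q => G (t q)) (wordSlice a t) = wordSlice a t := by
  set F := ExteriorAlgebra.ιMulti K d (M := W) with hF
  have hFinj := injective_alternatingMapLinearEquiv_ιMulti (K := K) (W := W) (d := d)
  have h1 : wordEval F b (colourChangeAt G a) = wordEval F b a := by
    rw [← wordEval_eq_wordEval_colourChangeAt F G (y := fun i => u (b i)) (y' := ⇑b) (fun s ℓ => hu s ℓ) a,
      ← exteriorAlgebra_map_wordEval, hx]
  have h2 : colourChangeAt G a = a := (ha.colourChangeAt G).eq_of_wordEval_eq hFinj b ha h1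
  rw [← wordSlice_colourChangeAt, h2]

/-- **`⋀(−1) = (−1)^d` on `⋀^d W`.** [cite: BourbakiAlgebre1a3, Ch. III §7 no. 2] -/
theorem map_neg_id_eq_of_mem {x : ExteriorAlgebra K W} (hx : x ∈ ⋀[K]^d W) :
    ExteriorAlgebra.map (-LinearMap.id : W →ₗ[K] W) x = ((-1 : K) ^ d) • x := by
  rw [← ExteriorAlgebra.ιMulti_span_fixedDegree] at hx
  induction hx using Submodule.span_induction with
  | mem y hy =>
    obtain ⟨v, rfl⟩ := hy
    rw [ExteriorAlgebra.map_apply_ιMulti]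
    have h1 : ((-LinearMap.id : W →ₗ[K] W) ∘ v) = fun i => (-1 : K) • v i := by
      funext i
      simp
    have h3 := (ExteriorAlgebra.ιMulti K d (M := W)).toMultilinearMap.map_smul_univ (fun _ => (-1 : K)) v
    simp only [AlternatingMap.coe_multilinearMap, Finset.prod_const, Finset.card_univ, Fintype.card_fin] at h3
    rw [h1, h3]
  | zero => rw [map_zero, smul_zero]
  | add y z _ _ hy hz => rw [map_add, hy, hz, smul_add]
  | smul c y _ hy => rw [map_smul, hy, smul_comm]

/-- **Odd degrees carry no `−1`-invariants**: if `⋀(−1) x = x` for `x ∈ ⋀^d W` with `d` odd then `x = 0` (characteristic `0`).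
[cite: Milne1999LefschetzClasses, §3 p. 654 ("for odd m, (H^{⊗m})^G = 0")] -/
theorem eq_zero_of_map_neg_eq_of_odd [CharZero K] {x : ExteriorAlgebra K W} (hx : x ∈ ⋀[K]^d W) (hd : Odd d)
    (h : ExteriorAlgebra.map (-LinearMap.id : W →ₗ[K] W) x = x) : x = 0 := by
  rw [map_neg_id_eq_of_mem hx, hd.neg_one_pow, neg_one_smul] at h
  have h2 : (2 : K) • x = 0 := by
    rw [two_smul]
    nth_rewrite 1 [← h]
    exact neg_add_cancel x
  rw [← inv_smul_smul₀ (two_ne_zero (α := K)) x, h2, smul_zero]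

end Coefficients

/-! ### §2 The contracted pair words are products of `2`-vectors -/

section PairWords

variable {K : Type*} [Field K] {W : Type*} [AddCommGroup W] [Module K W] {ι'' : Type*} {n : ℕ}

/-- `v₀ ∧ v₁ ∧ (w₀ ∧ ⋯) = (v₀ ∧ v₁) · (w₀ ∧ ⋯)` in `⋀ W`. [cite: BourbakiAlgebre1a3, Ch. III §7 no. 1] -/
theorem ιMulti_cons_cons {m : ℕ} (v₀ v₁ : W) (w : Fin m → W) :
    ExteriorAlgebra.ιMulti K (m + 1 + 1) (Fin.cons v₀ (Fin.cons v₁ w) : Fin (m + 1 + 1) → W) =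
      ExteriorAlgebra.ι K v₀ * ExteriorAlgebra.ι K v₁ * ExteriorAlgebra.ιMulti K m w := by
  have ht₁ : Matrix.vecTail (Fin.cons v₀ (Fin.cons v₁ w) : Fin (m + 1 + 1) → W) = Fin.cons v₁ w :=
    funext fun i => by simp [Matrix.vecTail]
  have ht₂ : Matrix.vecTail (Fin.cons v₁ w : Fin (m + 1) → W) = w :=
    funext fun i => by simp [Matrix.vecTail]
  rw [ExteriorAlgebra.ιMulti_succ_apply, ht₁, ExteriorAlgebra.ιMulti_succ_apply, ht₂, mul_assoc]
  rfl

/-- **The weighted sum over the letters of the contracted pair words, one weight matrix PER PAIR, is a PRODUCT of the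
crossed `2`-vectors `Σ_{a,a'} Θ_c(a,a') · y(I c, a) ∧ y(J c, a')`**, hence lies in every subalgebra `R ⊆ ⋀ W` containing
them ("each of which is visibly a product of `2`-forms", Prop. 3.6 / Remark 3.7) — the twin on `⋀ W` of
`Milne1999/SpecialLefschetzGroupInvariantsSpBlocksMultiplicity.sum_smul_cupPowOne_spPairWord_mem_family`.
[cite: Milne1999LefschetzClasses, Prop. 3.6, Remark 3.7 and p. 656] [cite: GoodmanWallachGTM255, Thm. 5.3.5] -/
theorem sum_smul_ιMulti_spPairWord_mem (y : ι'' × Fin n → W) (R : Subalgebra K (ExteriorAlgebra K W)) :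
    ∀ (m : ℕ) (Θ : Fin m → Matrix (Fin n) (Fin n) K) (I J : Fin m → ι''),
      (∀ c, (∑ a : Fin n, ∑ a' : Fin n,
        Θ c a a' • (ExteriorAlgebra.ι K (y (I c, a)) * ExteriorAlgebra.ι K (y (J c, a')))) ∈ R) →
      (∑ lam : Fin m → Fin n × Fin n, (∏ c, Θ c (lam c).1 (lam c).2) •
          ExteriorAlgebra.ιMulti K (2 * m) (spPairWord y I J lam)) ∈ R
  | 0, Θ, I, J, _ => by
    rw [Fintype.sum_unique, Finset.univ_eq_empty, Finset.prod_empty, one_smul]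
    change ExteriorAlgebra.ιMulti K 0 _ ∈ R
    rw [ExteriorAlgebra.ιMulti_zero_apply]
    exact R.one_mem
  | m + 1, Θ, I, J, hθ => by
    have IH := sum_smul_ιMulti_spPairWord_mem y R m (Fin.tail Θ) (Fin.tail I) (Fin.tail J) fun c => hθ c.succ
    have hterm : ∀ (ab : Fin n × Fin n) (lam' : Fin m → Fin n × Fin n),
        ExteriorAlgebra.ιMulti K (2 * (m + 1)) (spPairWord y I J (Fin.cons ab lam')) =
          ExteriorAlgebra.ι K (y (I 0, ab.1)) * ExteriorAlgebra.ι K (y (J 0, ab.2)) *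
            ExteriorAlgebra.ιMulti K (2 * m) (spPairWord y (Fin.tail I) (Fin.tail J) lam') := by
      intro ab lam'
      have hw : spPairWord y I J (Fin.cons ab lam') = (Fin.cons (y (I 0, ab.1)) (Fin.cons (y (J 0, ab.2))
          (spPairWord y (Fin.tail I) (Fin.tail J) lam')) : Fin (2 * m + 1 + 1) → W) := by
        funext q
        rw [spPairWord_succ_apply, Fin.cons_zero, Fin.tail_cons]
      rw [hw]
      change ExteriorAlgebra.ιMulti K (2 * m + 1 + 1) _ = _
      rw [ιMulti_cons_cons]
    have hsum : (∑ x : (Fin n × Fin n) × (Fin m → Fin n × Fin n),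
        (∏ c, Θ c (((Fin.consEquiv fun _ : Fin (m + 1) => Fin n × Fin n) x) c).1
          (((Fin.consEquiv fun _ : Fin (m + 1) => Fin n × Fin n) x) c).2) •
        ExteriorAlgebra.ιMulti K (2 * (m + 1))
          (spPairWord y I J ((Fin.consEquiv fun _ : Fin (m + 1) => Fin n × Fin n) x))) =
        (∑ a : Fin n, ∑ a' : Fin n,
            Θ 0 a a' • (ExteriorAlgebra.ι K (y (I 0, a)) * ExteriorAlgebra.ι K (y (J 0, a')))) *
          (∑ lam' : Fin m → Fin n × Fin n, (∏ c, Fin.tail Θ c (lam' c).1 (lam' c).2) •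
            ExteriorAlgebra.ιMulti K (2 * m) (spPairWord y (Fin.tail I) (Fin.tail J) lam')) := by
      rw [Fintype.sum_prod_type, ← Fintype.sum_prod_type' (fun a a' => Θ 0 a a' •
          (ExteriorAlgebra.ι K (y (I 0, a)) * ExteriorAlgebra.ι K (y (J 0, a')))), Finset.sum_mul]
      refine Finset.sum_congr rfl fun ab _ => ?_
      rw [Finset.mul_sum]
      refine Finset.sum_congr rfl fun lam' _ => ?_
      have hce : (Fin.consEquiv fun _ : Fin (m + 1) => Fin n × Fin n) (ab, lam') = Fin.cons ab lam' := rfl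
      rw [hce, Fin.prod_univ_succ, Fin.cons_zero]
      simp only [Fin.cons_succ]
      rw [hterm ab lam', smul_mul_smul_comm]
      rfl
    rw [← (Fin.consEquiv fun _ : Fin (m + 1) => Fin n × Fin n).sum_comp, hsum]
    exact R.mul_mem (hθ 0) IH

end PairWords

/-! ### §3 The letter-coloured criterion on `⋀• W` -/

section LetterColoured

/-- Matrices which are the identity off the letters of colour `i` are colour-preserving: an entry between letters of
different colours vanishes. [cite: Milne1999LefschetzClasses, §3 p. 656] -/
private theorem entry_eq_zero_of_lcol_ne' {K : Type*} [Field K] {ι : Type} {N : ℕ} (lcol : Fin N → ι) (i : ι)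
    (g : Matrix (Fin N) (Fin N) K)
    (hg : ∀ j j', (lcol j ≠ i ∨ lcol j' ≠ i) → g j' j = (1 : Matrix (Fin N) (Fin N) K) j' j)
    {j j' : Fin N} (h : lcol j' ≠ lcol j) : g j' j = 0 := by
  have hne : j' ≠ j := fun hh => h (by rw [hh])
  by_cases hj : lcol j = i
  · rw [hg j j' (Or.inr (by rw [← hj]; exact h)), Matrix.one_apply, if_neg hne]
  · rw [hg j j' (Or.inl hj), Matrix.one_apply, if_neg hne]

variable {K : Type*} [Field K] [CharZero K] {W : Type*} [AddCommGroup W] [Module K W]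
  {ι : Type} [Fintype ι] [DecidableEq ι] {N : ℕ}

/-- **Milne 1999, Prop. 3.4 with Prop. 3.6 (p. 656), letter-coloured form, on the exterior algebra `⋀ W`.**  DATA a basis
`b : Fin N → W`, a colouring `lcol : Fin N → ι` of the letters, for every colour a set `grp i` of `N × N` matrices which are
the identity off the letters of colour `i`, a set `ker i` of admissible pair kernels, the one-colour first fundamental theorem
`hone` (every `grp i`-invariant tensor supported on the letters of colour `i` is a combination of pair contractions with kernels
in `ker i` — supplied colour by colour by `ClassicalInvariants/TensorFFTLetterColoured`), a subgroup `G ≤ GL(W)` realising every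
`g ∈ grp i` (`u (b j) = Σ_{j'} g_{j' j} b_{j'}`), and a set `S ⊆ ⋀ W` whose generated subalgebra `K[S]` contains every kernel
`2`-vector `Σ M_{j j'} b_j ∧ b_{j'}`, `M ∈ ker i`.  CONCLUSION: every `x ∈ ⋀^{2p} W` with `⋀(u) x = x` for all `u ∈ G` lies
in `K[S]`.  Proof = p. 656, word for word the proof of the ℂ-Betti twin
`Milne1999/SpecialLefschetzGroupInvariantsLetterColouring.mem_divisorClassesSpan_of_forall_exteriorPullback_eq_of_letterColouring`:
antisymmetric coefficients (§1), invariant slices, colour patterns, the letter-coloured FFT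
`ClassicalInvariants.mem_span_pairContraction_of_invariant_aux` piece by piece, evaluation of each pair contraction on the basis
(`sum_colouredContraction_smul_eq`) as `±` a product of `p` kernel `2`-vectors (§2).
[cite: Milne1999LefschetzClasses, Prop. 3.4 (p. 653), Prop. 3.6 (p. 655) and p. 656]
[cite: GoodmanWallachGTM255, §4.1.1, Thm. 5.3.1, Thm. 5.3.3 and Thm. 5.3.5] -/
theorem mem_adjoin_of_forall_map_eq_of_letterColouring
    (b : Module.Basis (Fin N) K W) (lcol : Fin N → ι) (grp ker : ι → Set (Matrix (Fin N) (Fin N) K))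
    (hone : ∀ (i : ι) (P : Type) [Fintype P] [DecidableEq P] (c : (P → Fin N) → K),
      (∀ w, (∃ q, lcol (w q) ≠ i) → c w = 0) →
      (∀ g ∈ grp i, ∀ w' : P → Fin N, (∑ w, (∏ q, g (w' q) (w q)) * c w) = c w') →
      c ∈ Submodule.span K {f : (P → Fin N) → K |
        ∃ (k : ℕ) (e : P ≃ Fin 2 × Fin k) (M : Fin k → Matrix (Fin N) (Fin N) K),
          (∀ m, M m ∈ ker i) ∧ f = pairContraction M e})
    (hgrp : ∀ i, ∀ g ∈ grp i, ∀ j j', (lcol j ≠ i ∨ lcol j' ≠ i) → g j' j = (1 : Matrix (Fin N) (Fin N) K) j' j)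
    (G : Subgroup (W ≃ₗ[K] W)) (hG : ∀ i, ∀ g ∈ grp i, ∃ u ∈ G, ∀ j, u (b j) = ∑ j', g j' j • b j')
    (S : Set (ExteriorAlgebra K W))
    (hker : ∀ i, ∀ M ∈ ker i,
      (∑ j, ∑ j', M j j' • (ExteriorAlgebra.ι K (b j) * ExteriorAlgebra.ι K (b j'))) ∈ Algebra.adjoin K S)
    (p : ℕ) {x : ExteriorAlgebra K W} (hxm : x ∈ ⋀[K]^(2 * p) W)
    (hx : ∀ u ∈ G, ExteriorAlgebra.map (u : W →ₗ[K] W) x = x) :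
    x ∈ Algebra.adjoin K S := by
  classical
  set F := ExteriorAlgebra.ιMulti K (2 * p) (M := W) with hF
  set R := Algebra.adjoin K S with hR
  -- the basis, reindexed by `PUnit × Fin N` (one slot) to use the slice machinery of the tree
  let eU : Fin N ≃ Unit × Fin N := ⟨fun ℓ => ((), ℓ), fun q => q.2, fun _ => rfl, fun _ => rfl⟩
  let b' : Module.Basis (Unit × Fin N) K W := b.reindex eU
  have hb' : ∀ (s : Unit) (ℓ : Fin N), b' (s, ℓ) = b ℓ := fun s ℓ => by
    rw [Module.Basis.reindex_apply]
    rfl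
  obtain ⟨a, ha, hax⟩ := exists_isAntisymm_wordEval_ιMulti_eq b' hxm
  -- every slice is invariant under the Kronecker powers of every `g ∈ grp i`
  have hinv : ∀ (t : Fin (2 * p) → Unit) (i : ι), ∀ g ∈ grp i,
      wordRepAt K (fun _ => g) (wordSlice a t) = wordSlice a t := by
    intro t i g hg
    obtain ⟨u, huG, hu⟩ := hG i g hg
    exact wordRepAt_wordSlice_eq_of_map_wordEval_eq b' ha (u : W →ₗ[K] W) (fun _ => g)
      (fun s ℓ => by rw [hb']; simp_rw [hb']; exact hu ℓ) (by rw [hax]; exact hx u huG) t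
  rw [← hax, wordEval_eq_sum_wordSlice]
  refine R.sum_mem fun t _ => ?_
  set c := wordSlice a t with hc
  have hcinv : ∀ i, ∀ g ∈ grp i, ∀ w' : Word N (2 * p), ∑ w, (∏ q, g (w' q) (w q)) * c w = c w' := by
    intro i g hg w'
    have h := congrFun (hinv t i g hg) w'
    rwa [wordRepAt_apply] at h
  -- the pieces of `c` along the colour patterns of the words
  let piece : (Fin (2 * p) → ι) → Word N (2 * p) → K := fun κ w => if lcol ∘ w = κ then c w else 0
  have hsum : c = ∑ κ, piece κ := by
    funext w
    rw [Finset.sum_apply]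
    simp only [piece]
    rw [Finset.sum_ite_eq, if_pos (Finset.mem_univ _)]
  have hsupp : ∀ κ (w : Word N (2 * p)), (∃ q, lcol (w q) ≠ κ q) → piece κ w = 0 := by
    rintro κ w ⟨q, hq⟩
    simp only [piece]
    rw [if_neg]
    intro h
    exact hq (congrFun h q)
  -- each piece is invariant, colour by colour
  have hpinv : ∀ (κ : Fin (2 * p) → ι) (i : ι), ∀ g ∈ grp i, ∀ w' : Word N (2 * p),
      (∑ w, (∏ q, (if κ q = i then g else 1) (w' q) (w q)) * piece κ w) = piece κ w' := by
    intro κ i g hg w'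
    have hg' := hgrp i g hg
    by_cases hw' : lcol ∘ w' = κ
    · have hRp : piece κ w' = c w' := if_pos hw'
      rw [hRp, ← hcinv i g hg w']
      refine Finset.sum_congr rfl fun w _ => ?_
      by_cases hw : lcol ∘ w = κ
      · have hL : piece κ w = c w := if_pos hw
        rw [hL]
        congr 1
        refine Finset.prod_congr rfl fun q _ => ?_
        by_cases hq : κ q = i
        · rw [if_pos hq]
        · rw [if_neg hq]
          have h1 : lcol (w q) ≠ i := by rw [show lcol (w q) = κ q from congrFun hw q]; exact hq
          rw [hg' _ _ (Or.inl h1)]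
      · have hL : piece κ w = 0 := if_neg hw
        rw [hL, mul_zero]
        obtain ⟨q, hq⟩ : ∃ q, lcol (w q) ≠ κ q := by
          by_contra hall
          push Not at hall
          exact hw (funext hall)
        have hne : lcol (w' q) ≠ lcol (w q) := by
          rw [show lcol (w' q) = κ q from congrFun hw' q]; exact fun h => hq h.symm
        rw [Finset.prod_eq_zero (Finset.mem_univ q) (entry_eq_zero_of_lcol_ne' lcol i g hg' hne), zero_mul]
    · have hRp : piece κ w' = 0 := if_neg hw'
      rw [hRp]
      refine Finset.sum_eq_zero fun w _ => ?_
      by_cases hw : lcol ∘ w = κ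
      · obtain ⟨q, hq⟩ : ∃ q, lcol (w' q) ≠ κ q := by
          by_contra hall
          push Not at hall
          exact hw' (funext hall)
        have hne : lcol (w' q) ≠ lcol (w q) := by
          rw [show lcol (w q) = κ q from congrFun hw q]; exact hq
        have h0 : (if κ q = i then g else 1) (w' q) (w q) = 0 := by
          by_cases hqi : κ q = i
          · rw [if_pos hqi]; exact entry_eq_zero_of_lcol_ne' lcol i g hg' hne
          · rw [if_neg hqi, Matrix.one_apply, if_neg]
            intro h; exact hne (by rw [h])
        rw [Finset.prod_eq_zero (Finset.mem_univ q) h0, zero_mul]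
      · rw [show piece κ w = 0 from if_neg hw, mul_zero]
  -- the letter-coloured FFT, piece by piece
  have hmem : ∀ κ : Fin (2 * p) → ι, piece κ ∈ Submodule.span K {f : Word N (2 * p) → K |
      ∃ (k : ℕ) (e : Fin (2 * p) ≃ Fin 2 × Fin k) (M : Fin k → Matrix (Fin N) (Fin N) K),
        (∀ m, κ (e.symm (0, m)) = κ (e.symm (1, m)) ∧ M m ∈ ker (κ (e.symm (0, m)))) ∧
          f = pairContraction M e} :=
    fun κ => mem_span_pairContraction_of_invariant_aux lcol grp ker hone (2 * p) (Fin (2 * p)) κ (piece κ)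
      (Fintype.card_fin _) (hsupp κ) (hpinv κ)
  -- evaluation on the basis
  set Λ := Fintype.linearCombination K (fun ε : Word N (2 * p) => F (fun q => b' (t q, ε q))) with hΛ
  have hΛapply : ∀ c' : Word N (2 * p) → K, Λ c' = ∑ ε, c' ε • F (fun q => b' (t q, ε q)) :=
    fun c' => Fintype.linearCombination_apply K _ c'
  rw [← hΛapply, hsum, map_sum]
  refine R.sum_mem fun κ _ => ?_
  refine (Submodule.span_le (p := (Subalgebra.toSubmodule R).comap Λ)).2 ?_ (hmem κ)
  rintro _ ⟨k, e, M, he, rfl⟩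
  rw [SetLike.mem_coe, Submodule.mem_comap, Subalgebra.mem_toSubmodule, hΛapply]
  have hk : k = p := by
    have h := Fintype.card_congr e
    simp only [Fintype.card_fin, Fintype.card_prod] at h
    omega
  subst hk
  have hpc : pairContraction M e = colouredContraction M (fun q => (e q).2) e := by
    funext w
    rw [pairContraction_apply, colouredContraction_apply]
    refine Finset.prod_congr rfl fun m _ => ?_
    rw [Equiv.apply_symm_apply]
  rw [hpc]
  obtain ⟨π, -, hs⟩ := sum_colouredContraction_smul_eq F M (fun q => (e q).2) e (⇑b') t
  rw [hs]
  refine R.smul_mem ?_ _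
  refine sum_smul_ιMulti_spPairWord_mem (⇑b') R k (fun m => M (e (e.symm (0, m))).2) _ _ fun m => ?_
  simp_rw [Equiv.apply_symm_apply, hb']
  exact hker _ (M m) (he m).2

end LetterColoured

/-! ### §4 The kernel `2`-vectors are invariant under the isometries commuting with their operators -/

section KernelTwoVectors

variable {K : Type*} [Field K] {W : Type*} [AddCommGroup W] [Module K W] {N : ℕ}

/-- A `K`-combination of wedges `β_j ∧ β_{j'}` lies in `⋀² W`. [cite: BourbakiAlgebre1a3, Ch. III §7 no. 1] -/
theorem sum_smul_ι_mul_ι_mem_exteriorPower_two (β : Fin N → W) (M : Matrix (Fin N) (Fin N) K) :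
    (∑ j, ∑ j', M j j' • (ExteriorAlgebra.ι K (β j) * ExteriorAlgebra.ι K (β j'))) ∈ ⋀[K]^2 W := by
  refine Submodule.sum_mem _ fun j _ => Submodule.sum_mem _ fun j' _ => Submodule.smul_mem _ _ ?_
  rw [ExteriorAlgebra.exteriorPower, pow_two]
  exact Submodule.mul_mem_mul (LinearMap.mem_range_self _ _) (LinearMap.mem_range_self _ _)

/-- **The contraction form of the kernel `2`-vector against `B(v, ·)`**: for `κ_M = Σ M_{jj'} β_j ∧ β_{j'}` and the operator
`X v = Σ M_{jj'} (B(v, β_{j'}) β_j − B(v, β_j) β_{j'})` (the shape delivered by the adapted colouring, fields `form_kernel` /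
`pair_kernel` of `ClassicalInvariants.AdaptedColouring`): `B_{κ_M}(B(v, ·), ψ) = ψ(X v)`.
[cite: BourbakiAlgebre1a3, Ch. III §11 no. 9] [cite: Milne1999LefschetzClasses, §1 Prop. 1.3 and §3 Prop. 3.3] -/
theorem contractionForm_kernelTwoVector (B : LinearMap.BilinForm K W) (β : Fin N → W) (M : Matrix (Fin N) (Fin N) K)
    {X : Module.End K W} (hX : ∀ v, X v = ∑ j, ∑ j', M j j' • (B v (β j') • β j - B v (β j) • β j'))
    (v : W) (ψ : Module.Dual K W) :
    contractionForm (∑ j, ∑ j', M j j' • (ExteriorAlgebra.ι K (β j) * ExteriorAlgebra.ι K (β j'))) (B v) ψ =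
      ψ (X v) := by
  rw [hX v, map_sum]
  simp only [contractionForm_sum, contractionForm_smul, LinearMap.smul_apply, contractionForm_ι_mul_ι, map_sum,
    map_smul, map_sub, smul_eq_mul]

/-- **An isometry of `B` commuting with the operator `X` of a kernel `2`-vector fixes the kernel `2`-vector**
(`B` non-degenerate, characteristic `0`): `⋀(u) κ_M = κ_M` — both sides are `2`-vectors with the same contraction form,
`B_{⋀(u)κ}(B(v,·), ψ) = B_κ(B(u⁻¹v, ·), ψ ∘ u) = ψ(u X u⁻¹ v) = ψ(X v)`.  This is the exterior-algebra form of the step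
"the degree-`2` invariants `ψ ∘ (γ × 1) = ψ ∘ (1 × γ†)`, `γ ∈ S(A)(k)`" of the proof of Prop. 3.3.
[cite: Milne1999LefschetzClasses, §3 proof of Prop. 3.3 (p. 653)] [cite: BourbakiAlgebre1a3, Ch. III §11 no. 9] -/
theorem map_kernelTwoVector_eq [CharZero K] [FiniteDimensional K W] {B : LinearMap.BilinForm K W}
    (hB : B.Nondegenerate) (β : Fin N → W) (M : Matrix (Fin N) (Fin N) K) {X : Module.End K W}
    (hX : ∀ v, X v = ∑ j, ∑ j', M j j' • (B v (β j') • β j - B v (β j) • β j'))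
    (u : W ≃ₗ[K] W) (hcomm : ∀ v, X (u v) = u (X v)) (hiso : ∀ v w, B (u v) (u w) = B v w) :
    ExteriorAlgebra.map (u : W →ₗ[K] W)
        (∑ j, ∑ j', M j j' • (ExteriorAlgebra.ι K (β j) * ExteriorAlgebra.ι K (β j'))) =
      ∑ j, ∑ j', M j j' • (ExteriorAlgebra.ι K (β j) * ExteriorAlgebra.ι K (β j')) := by
  set κ := ∑ j, ∑ j', M j j' • (ExteriorAlgebra.ι K (β j) * ExteriorAlgebra.ι K (β j')) with hκ
  have hκ2 : κ ∈ ⋀[K]^2 W := sum_smul_ι_mul_ι_mem_exteriorPower_two β M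
  have hκ2' : ExteriorAlgebra.map (u : W →ₗ[K] W) κ ∈ ⋀[K]^2 W := by
    have h := (exteriorPower.map 2 (u : W →ₗ[K] W) ⟨κ, hκ2⟩).2
    rwa [coe_exteriorPower_map] at h
  refine eq_of_contractionForm_eq (isUnit_iff_ne_zero.2 two_ne_zero) hκ2' hκ2
    (LinearMap.ext fun φ => LinearMap.ext fun ψ => ?_)
  obtain ⟨v, rfl⟩ := exists_eq_apply hB φ
  rw [contractionForm_map _ hκ2]
  have hφ : B v ∘ₗ (u : W →ₗ[K] W) = B (u.symm v) := by
    ext w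
    rw [LinearMap.comp_apply, LinearEquiv.coe_coe, ← hiso (u.symm v) w, LinearEquiv.apply_symm_apply]
  rw [hφ, contractionForm_kernelTwoVector B β M hX, contractionForm_kernelTwoVector B β M hX, LinearMap.comp_apply,
    LinearEquiv.coe_coe, ← hcomm, LinearEquiv.apply_symm_apply]

end KernelTwoVectors

/-! ### §5 Main theorem: the `S(E, B)`-invariants of `⋀• W` are generated by those of degree `2` -/

section Main

variable {K : Type*} [Field K] [CharZero K] [IsAlgClosed K] {W : Type*} [AddCommGroup W] [Module K W]
  [FiniteDimensional K W]

/-- **Milne 1999, Prop. 3.4 (`r = 1`) with §2 and Prop. 3.6, abstract form: `(⋀^m W)^{S(E,B)} ⊆ K[(⋀² W)^{S(E,B)}]`.**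
Let `K` be algebraically closed of characteristic `0`, `B` a non-degenerate alternating form on the finite-dimensional `W`,
`E ⊆ End_K W` a semisimple subalgebra stable under the `B`-adjoint (`hE`), and `G ≤ GL(W)` the group `S(E, B)` — membership
in `G` is "commutes with every `X ∈ E` and preserves `B`" (`hG`; Milne's `S(A)(k) = {γ ∈ C(A) ⊗ k | γ†γ = 1}` for
`W = V(A) ⊗ k`, `B = e_D`, `E = End⁰(A) ⊗ k`).  Then every `x ∈ ⋀^m W` with `⋀(u) x = x` for all `u ∈ G` lies in the
`K`-subalgebra of `⋀ W` generated by the `G`-invariant `2`-vectors ("`H^*(A^r)^{S(A)} = k[H²(A^r)^{S(A)}]`").  Proof (Milne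
pp. 654–656 as assembled in `Milne1999/SpecialLefschetzGroupInvariantsHolds` on the ℂ-Betti carrier): odd `m` — `−1 ∈ G`;
`m = 2p` — the adapted letter colouring of `(W, B, E)` (`ClassicalInvariants.exists_adaptedColouring_of_isAlgClosed`, Milne
§2) feeds the criterion of §3 with the one-colour FFTs `mem_span_pairContraction_of_formBlock_invariant` (Prop. 3.6 (a)/(b))
and `…_of_glBlock_invariant` (Prop. 3.6 (c)); its block-group matrices are `E`-linear `B`-isometries, hence in `G` by `hG`;
its kernel `2`-vectors have operators in `E`, hence are `G`-invariant by §4.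
[cite: Milne1999LefschetzClasses, Thm. 3.2, Prop. 3.4 (p. 653), §2 pp. 645–651, Prop. 3.6 (pp. 654–655), p. 656]
[cite: GoodmanWallachGTM255, Thm. 5.3.1, Thm. 5.3.3 and Thm. 5.3.5] -/
theorem mem_adjoin_of_forall_map_eq {B : LinearMap.BilinForm K W} (hB : B.Nondegenerate) (hBa : B.IsAlt)
    (E : Subalgebra K (Module.End K W)) [IsSemisimpleRing E]
    (hE : ∀ X ∈ E, ∃ Y ∈ E, ∀ v w, B (Y v) w = B v (X w))
    (G : Subgroup (W ≃ₗ[K] W))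
    (hG : ∀ u : W ≃ₗ[K] W, u ∈ G ↔ (∀ X ∈ E, ∀ v, X (u v) = u (X v)) ∧ ∀ v w, B (u v) (u w) = B v w)
    {m : ℕ} {x : ExteriorAlgebra K W} (hxm : x ∈ ⋀[K]^m W)
    (hx : ∀ u ∈ G, ExteriorAlgebra.map (u : W →ₗ[K] W) x = x) :
    x ∈ Algebra.adjoin K {y : ExteriorAlgebra K W |
      y ∈ ⋀[K]^2 W ∧ ∀ u ∈ G, ExteriorAlgebra.map (u : W →ₗ[K] W) y = y} := by
  classical
  rcases Nat.even_or_odd m with ⟨p, rfl⟩ | hodd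
  swap
  · -- odd degree: `−1 ∈ G` acts by `−1`
    have hneg : LinearEquiv.neg K ∈ G := by
      refine (hG _).2 ⟨fun X _ v => ?_, fun v w => ?_⟩
      · change X (-v) = -(X v)
        exact map_neg X v
      · change B (-v) (-w) = B v w
        simp only [map_neg, LinearMap.neg_apply, neg_neg]
    have h1 : ((LinearEquiv.neg K : W ≃ₗ[K] W) : W →ₗ[K] W) = -LinearMap.id := LinearMap.ext fun v => rfl
    have h0 : x = 0 := eq_zero_of_map_neg_eq_of_odd hxm hodd (by rw [← h1]; exact hx _ hneg)
    rw [h0]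
    exact Subalgebra.zero_mem _
  · -- even degree `m = p + p = 2 p`: the adapted letter colouring and the criterion of §3
    rw [← two_mul] at hxm
    obtain ⟨C⟩ := exists_adaptedColouring_of_isAlgClosed B hB hBa E hE
    letI := C.instFintype
    letI := C.instDecEq
    letI := C.instDec
    have hsq : ∀ a : K, IsSquare a := fun a => IsAlgClosed.exists_eq_mul_self a
    refine mem_adjoin_of_forall_map_eq_of_letterColouring C.β C.lcol
      (fun i => if C.IsForm i then formBlockGroup (C.ltr i) (C.Ω i) else glBlockGroup (C.ltr i) (C.ltr₁ i))
      (fun i => if C.IsForm i then formBlockKernels (C.ltr i) (C.Ω i) else glBlockKernels (C.ltr i) (C.ltr₁ i))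
      ?_ ?_ G ?_ _ ?_ p hxm hx
    · -- the one-colour first fundamental theorems (Prop. 3.6 (a), (b), (c))
      intro i P _ _ c hsupp hc
      by_cases hi : C.IsForm i
      · simp only [if_pos hi] at hc ⊢
        refine mem_span_pairContraction_of_formBlock_invariant hsq (C.ltr_injective i hi)
          (C.Ω_isAlt_or_isSymm i hi) (C.Ω_nondegenerate i hi) P c (fun w hw => hsupp w ?_) hc
        obtain ⟨q, hq⟩ := hw
        refine ⟨q, fun h => hq ?_⟩
        rw [C.range_ltr i hi]
        exact h
      · simp only [if_neg hi] at hc ⊢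
        refine mem_span_pairContraction_of_glBlock_invariant (C.sum_injective i hi) P c (fun w hw => hsupp w ?_) hc
        obtain ⟨q, hq1, hq2⟩ := hw
        refine ⟨q, fun h => ?_⟩
        have hq : w q ∈ Set.range (C.ltr i) ∪ Set.range (C.ltr₁ i) := by
          rw [C.range_union i hi]; exact h
        exact hq.elim hq1 hq2
    · -- block group matrices are the identity off their colour
      intro i g hg j j' hjj'
      by_cases hi : C.IsForm i
      · simp only [if_pos hi] at hg
        obtain ⟨_, _, _, h3, h4⟩ := hg
        rcases hjj' with h | h
        · exact h3 _ _ (by rw [C.range_ltr i hi]; exact h)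
        · exact h4 _ _ (by rw [C.range_ltr i hi]; exact h)
      · simp only [if_neg hi] at hg
        obtain ⟨_, _, _, _, _, h5, h6⟩ := hg
        rcases hjj' with h | h
        · have hn : j ∉ Set.range (C.ltr i) ∪ Set.range (C.ltr₁ i) := by rw [C.range_union i hi]; exact h
          exact h5 _ _ (fun hh => hn (Or.inl hh)) (fun hh => hn (Or.inr hh))
        · have hn : j' ∉ Set.range (C.ltr i) ∪ Set.range (C.ltr₁ i) := by rw [C.range_union i hi]; exact h
          exact h6 _ _ (fun hh => hn (Or.inl hh)) (fun hh => hn (Or.inr hh))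
    · -- block group elements are `E`-linear `B`-isometries, hence realised in `G = S(E, B)`
      intro i g hg
      have key : (∀ X ∈ E, X * Matrix.toLin C.β C.β g = Matrix.toLin C.β C.β g * X) ∧
          ∀ v w, B (Matrix.toLin C.β C.β g v) (Matrix.toLin C.β C.β g w) = B v w := by
        by_cases hi : C.IsForm i
        · simp only [if_pos hi] at hg
          exact C.form_group i hi g hg
        · simp only [if_neg hi] at hg
          exact C.pair_group i hi g hg
      obtain ⟨hcomm, hiso⟩ := key
      set T := Matrix.toLin C.β C.β g with hT
      have hinj : Function.Injective T := by
        intro v v' hvv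
        rw [← sub_eq_zero]
        refine hB.1 _ fun w => ?_
        rw [← hiso, map_sub, hvv, sub_self, LinearMap.BilinForm.zero_left]
      let u : W ≃ₗ[K] W := LinearEquiv.ofBijective T ⟨hinj, LinearMap.surjective_of_injective hinj⟩
      have hu : ∀ v, u v = T v := fun v => rfl
      refine ⟨u, (hG u).2 ⟨fun X hX v => ?_, fun v w => ?_⟩, fun j => ?_⟩
      · have h := LinearMap.congr_fun (hcomm X hX) v
        rw [Module.End.mul_apply, Module.End.mul_apply] at h
        rw [hu, hu]
        exact h
      · rw [hu, hu, hiso]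
      · rw [hu, hT, Matrix.toLin_self]
    · -- kernel `2`-vectors have operators in `E`, hence are `G`-invariant (§4)
      intro i M hM
      have key : ∃ X ∈ E, ∀ v,
          X v = ∑ j, ∑ j', M j j' • (B v (C.β j') • C.β j - B v (C.β j) • C.β j') := by
        by_cases hi : C.IsForm i
        · simp only [if_pos hi] at hM
          exact C.form_kernel i hi M hM
        · simp only [if_neg hi] at hM
          exact C.pair_kernel i hi M hM
      obtain ⟨X, hXm, hXv⟩ := key
      refine Algebra.subset_adjoin ⟨sum_smul_ι_mul_ι_mem_exteriorPower_two _ M, fun u hu => ?_⟩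
      obtain ⟨hc, hi⟩ := (hG u).1 hu
      exact map_kernelTwoVector_eq hB _ M hXv u (fun v => hc X hXm v) hi

/-- **The same on Mathlib's graded piece `x : ⋀[K]^m W` with `u` acting by `exteriorPower.map m u`.**
[cite: Milne1999LefschetzClasses, Thm. 3.2 and Prop. 3.4 (p. 653)] -/
theorem coe_mem_adjoin_of_forall_exteriorPower_map_eq {B : LinearMap.BilinForm K W} (hB : B.Nondegenerate)
    (hBa : B.IsAlt) (E : Subalgebra K (Module.End K W)) [IsSemisimpleRing E]
    (hE : ∀ X ∈ E, ∃ Y ∈ E, ∀ v w, B (Y v) w = B v (X w))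
    (G : Subgroup (W ≃ₗ[K] W))
    (hG : ∀ u : W ≃ₗ[K] W, u ∈ G ↔ (∀ X ∈ E, ∀ v, X (u v) = u (X v)) ∧ ∀ v w, B (u v) (u w) = B v w)
    {m : ℕ} (x : ⋀[K]^m W) (hx : ∀ u ∈ G, exteriorPower.map m (u : W →ₗ[K] W) x = x) :
    (x : ExteriorAlgebra K W) ∈ Algebra.adjoin K {y : ExteriorAlgebra K W |
      y ∈ ⋀[K]^2 W ∧ ∀ u ∈ G, ExteriorAlgebra.map (u : W →ₗ[K] W) y = y} :=
  mem_adjoin_of_forall_map_eq hB hBa E hE G hG x.2 fun u hu => by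
    rw [← coe_exteriorPower_map, hx u hu]

/-- **Odd degrees: `(⋀^m W)^{S(E,B)} = 0` for `m` odd** (`−1 ∈ S(E, B)`; no structure theory needed, any field of
characteristic `0`). [cite: Milne1999LefschetzClasses, §3 p. 654 ("for odd m, (H^{⊗m})^G = 0")] -/
theorem eq_zero_of_forall_map_eq_of_odd {K : Type*} [Field K] [CharZero K] {W : Type*} [AddCommGroup W] [Module K W]
    {B : LinearMap.BilinForm K W} (E : Subalgebra K (Module.End K W)) (G : Subgroup (W ≃ₗ[K] W))
    (hG : ∀ u : W ≃ₗ[K] W, u ∈ G ↔ (∀ X ∈ E, ∀ v, X (u v) = u (X v)) ∧ ∀ v w, B (u v) (u w) = B v w)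
    {m : ℕ} (hm : Odd m) {x : ExteriorAlgebra K W} (hxm : x ∈ ⋀[K]^m W)
    (hx : ∀ u ∈ G, ExteriorAlgebra.map (u : W →ₗ[K] W) x = x) : x = 0 := by
  have hneg : LinearEquiv.neg K ∈ G := by
    refine (hG _).2 ⟨fun X _ v => ?_, fun v w => ?_⟩
    · change X (-v) = -(X v)
      exact map_neg X v
    · change B (-v) (-w) = B v w
      simp only [map_neg, LinearMap.neg_apply, neg_neg]
  have h1 : ((LinearEquiv.neg K : W ≃ₗ[K] W) : W →ₗ[K] W) = -LinearMap.id := LinearMap.ext fun v => rfl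
  exact eq_zero_of_map_neg_eq_of_odd hxm hm (by rw [← h1]; exact hx _ hneg)

end Main

/-! ### §6 The whole algebra: `(⋀ W)^{S(E,B)} = K[(⋀² W)^{S(E,B)}]` -/

section WholeAlgebra

variable {K : Type*} [Field K] {W : Type*} [AddCommGroup W] [Module K W]

open DirectSum in
/-- **`⋀(u)` commutes with the projections onto the graded pieces `⋀^i W`** (it preserves every `⋀^i W` and the
decomposition `⋀ W = ⊕_i ⋀^i W` is unique). [cite: BourbakiAlgebre1a3, Ch. III §7 no. 1–2] -/
theorem coe_decompose_map (u : W →ₗ[K] W) (x : ExteriorAlgebra K W) (i : ℕ) :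
    ((decompose (fun i : ℕ => ⋀[K]^i W) (ExteriorAlgebra.map u x) i : ⋀[K]^i W) : ExteriorAlgebra K W) =
      ExteriorAlgebra.map u ((decompose (fun i : ℕ => ⋀[K]^i W) x i : ⋀[K]^i W) : ExteriorAlgebra K W) := by
  induction x using DirectSum.Decomposition.inductionOn (fun i : ℕ => ⋀[K]^i W) with
  | zero => rw [map_zero, decompose_zero (fun i : ℕ => ⋀[K]^i W), DirectSum.zero_apply, ZeroMemClass.coe_zero, map_zero]
  | @homogeneous j y =>
    have hy' : ExteriorAlgebra.map u (y : ExteriorAlgebra K W) ∈ ⋀[K]^j W := by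
      have h := (exteriorPower.map j u y).2
      rwa [coe_exteriorPower_map] at h
    by_cases hij : j = i
    · subst hij
      rw [decompose_of_mem_same (fun i : ℕ => ⋀[K]^i W) hy', decompose_of_mem_same (fun i : ℕ => ⋀[K]^i W) y.2]
    · rw [decompose_of_mem_ne (fun i : ℕ => ⋀[K]^i W) hy' hij, decompose_of_mem_ne (fun i : ℕ => ⋀[K]^i W) y.2 hij,
        map_zero]
  | add y z hy hz =>
    rw [map_add, decompose_add (fun i : ℕ => ⋀[K]^i W), DirectSum.add_apply, Submodule.coe_add, hy, hz,
      decompose_add (fun i : ℕ => ⋀[K]^i W), DirectSum.add_apply, Submodule.coe_add, map_add]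

open DirectSum in
/-- **Invariance passes to the homogeneous components**: if `⋀(u) x = x` then `⋀(u) x_i = x_i` for every graded
component `x_i ∈ ⋀^i W` of `x`. [cite: BourbakiAlgebre1a3, Ch. III §7 no. 1–2] -/
theorem map_decompose_eq_of_map_eq (u : W →ₗ[K] W) {x : ExteriorAlgebra K W} (hx : ExteriorAlgebra.map u x = x)
    (i : ℕ) :
    ExteriorAlgebra.map u ((decompose (fun i : ℕ => ⋀[K]^i W) x i : ⋀[K]^i W) : ExteriorAlgebra K W) =
      ((decompose (fun i : ℕ => ⋀[K]^i W) x i : ⋀[K]^i W) : ExteriorAlgebra K W) := by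
  rw [← coe_decompose_map, hx]

variable [CharZero K] [IsAlgClosed K] [FiniteDimensional K W]

open DirectSum in
/-- **Milne 1999, Prop. 3.4 (`r = 1`) for the whole algebra, abstract form: `(⋀ W)^{S(E,B)} = K[(⋀² W)^{S(E,B)}]`** —
EVERY element of the exterior algebra (homogeneous or not) fixed by `S(E, B)` is a polynomial in `S(E, B)`-invariant
`2`-vectors (the invariants form a graded subalgebra: each homogeneous component of an invariant is invariant,
`map_decompose_eq_of_map_eq`, and `mem_adjoin_of_forall_map_eq` degree by degree); the reverse inclusion is trivial.
[cite: Milne1999LefschetzClasses, Thm. 3.2 and Prop. 3.4 (p. 653)] -/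
theorem mem_adjoin_of_forall_map_eq' {B : LinearMap.BilinForm K W} (hB : B.Nondegenerate) (hBa : B.IsAlt)
    (E : Subalgebra K (Module.End K W)) [IsSemisimpleRing E]
    (hE : ∀ X ∈ E, ∃ Y ∈ E, ∀ v w, B (Y v) w = B v (X w))
    (G : Subgroup (W ≃ₗ[K] W))
    (hG : ∀ u : W ≃ₗ[K] W, u ∈ G ↔ (∀ X ∈ E, ∀ v, X (u v) = u (X v)) ∧ ∀ v w, B (u v) (u w) = B v w)
    {x : ExteriorAlgebra K W} (hx : ∀ u ∈ G, ExteriorAlgebra.map (u : W →ₗ[K] W) x = x) :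
    x ∈ Algebra.adjoin K {y : ExteriorAlgebra K W |
      y ∈ ⋀[K]^2 W ∧ ∀ u ∈ G, ExteriorAlgebra.map (u : W →ₗ[K] W) y = y} := by
  classical
  rw [← sum_support_decompose (fun i : ℕ => ⋀[K]^i W) x]
  refine Subalgebra.sum_mem _ fun i _ => ?_
  exact mem_adjoin_of_forall_map_eq hB hBa E hE G hG (decompose (fun i : ℕ => ⋀[K]^i W) x i).2
    fun u hu => map_decompose_eq_of_map_eq (u : W →ₗ[K] W) (hx u hu) i

/-- … and conversely every element of `K[(⋀² W)^{S(E,B)}]` is `S(E, B)`-invariant (`⋀(u)` is an algebra map), so that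
**`(⋀ W)^{S(E,B)} = K[(⋀² W)^{S(E,B)}]` as sets**. [cite: Milne1999LefschetzClasses, Prop. 3.4 (p. 653)] -/
theorem setOf_forall_map_eq_eq_adjoin {B : LinearMap.BilinForm K W} (hB : B.Nondegenerate) (hBa : B.IsAlt)
    (E : Subalgebra K (Module.End K W)) [IsSemisimpleRing E]
    (hE : ∀ X ∈ E, ∃ Y ∈ E, ∀ v w, B (Y v) w = B v (X w))
    (G : Subgroup (W ≃ₗ[K] W))
    (hG : ∀ u : W ≃ₗ[K] W, u ∈ G ↔ (∀ X ∈ E, ∀ v, X (u v) = u (X v)) ∧ ∀ v w, B (u v) (u w) = B v w) :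
    {x : ExteriorAlgebra K W | ∀ u ∈ G, ExteriorAlgebra.map (u : W →ₗ[K] W) x = x} =
      Algebra.adjoin K {y : ExteriorAlgebra K W |
        y ∈ ⋀[K]^2 W ∧ ∀ u ∈ G, ExteriorAlgebra.map (u : W →ₗ[K] W) y = y} := by
  refine Set.Subset.antisymm (fun x hx => mem_adjoin_of_forall_map_eq' hB hBa E hE G hG hx) fun x hx u hu => ?_
  refine Algebra.adjoin_induction (fun y hy => hy.2 u hu) (fun r => AlgHom.commutes _ r)
    (fun y z _ _ hy hz => by rw [map_add, hy, hz]) (fun y z _ _ hy hz => by rw [map_mul, hy, hz]) hx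

end WholeAlgebra

end Literature.AlgebraicGeometry.Milne1999

end
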